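import Summits.HodgeConjecture.HodgeConjecture.Theorems.F0P2oBlockFrameChartFactorisation       -- (BE)∕(C4) B-p18 (g29) p838184: `exists_fibre_boxSB_eq_smul_blockFrame` (+ chart ★ p835408)
import Summits.HodgeConjecture.HodgeConjecture.Theorems.F0P2oBlockAdaptedCongruence           -- (BF) ★ p837182 A-p16 (g24): `diagonal_eq_finSum_realDiagonal_map`, `localPiEquiv_symm_eq_inlLoc`
import Summits.HodgeConjecture.HodgeConjecture.Theorems.F0P2oLineWeilDictionaryFrameTransportOfRecord  -- (FX) ★ p837171 A-p01 (g19): `chiLocalSplittingsCM_s_eq_localSplittingCM`, `lineSplittingsCM_s_eq_localSplittingCM`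
import Summits.HodgeConjecture.HodgeConjecture.Theorems.F0P2oLineWeilCMLineMatching            -- (LM) ★ p836568 B-p10 (g22): `exists_intertwiner_lineWeilCM_of_eq_mul_norm`
import Summits.HodgeConjecture.HodgeConjecture.Theorems.F0P2oN3OfLineJacquet                   -- ★ p837961 F0P2-p06 (g4): the (N′) socket `thetaType_nonsplit_jacquetModule_of_lineJacquet`
import Summits.HodgeConjecture.HodgeConjecture.Theorems.F0P2oN3TorusWeightOfD3d                -- ★ `coinvariantsKer_restrict_eq`
import Summits.HodgeConjecture.HodgeConjecture.Theorems.F0P2oJacquetChartUniqueness            -- ★ p835047 A-p12 (g17): `exists_linearEquiv_comp_eq`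
import Literature.NumberTheory.GelbartRogawski1991.LocalSplittingCMBlockRestriction           -- (LS) ★ p836839 B-p18 (g29): `DoubledBlock.toRep_localSplittingCMWith_inlLoc_boxSB_of_eq`
import Summits.HodgeConjecture.HodgeConjecture.Theorems.F0P2oCMBlockFrameGram                  -- (β)∕(BD) ★ p838316 B-p08 (g25): `gram_prodUnique_realDiagonal_eq_finSum`, `localLineInl_prodUnique_inlLoc_blockFrame`
import Literature.RepresentationTheory.HeisenbergGroup.SchrodingerFibreSurjective            -- (SJ-gen) ★ p838353 F0P2-p02 (g7): `surjective_of_fibre_formula`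
import HarnessLib

/-!
# Crux `H413`, programme P2, N3 road (a) — (C5) «(N′) AT THE BLOCK FRAME»: the line-Jacquet intertwiner
# `r_N(ω_v ∘ ch_{T₀}) ≃ 𝒮(L⁺_v)` carrying `d(1, β, 1)` to the rank-one Weil operator `ω¹_{(t),ε}(β)` at a block-adapted congruence `T₀`

Cell hodgecm-mathlib (D-0151), FLOOR 0, crux item H413 = stmt-HodgeConjecture-24833, programme P2; N3 road v3 (`F0/P2/B-p18/g29/N3-ROAD.v3.B-p18g29.md`),
(a)-block, brick (C5) (lead B-p18 (g29) deal 2026-08-31T23:35:17Z → B-p10 (g23)).  THEOREMS ONLY (no `def`, no instance, no notation, no named fact, no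
`sorry`); never imports a `Cruxes/…/Lines` module; kernel lane `--supports stmt-HodgeConjecture-24833 --as helper`.  HC_CM is proved only modulo the
printed citations (2 remaining named inputs hLiu418, h413) until rung 0 closes; nothing printed is asserted here.

WHAT.  At a finite place `v` of `L⁺` NON-SPLIT in `L`, for a real non-zero diagonal `dV = (t ‖ a₁, a₂)` (line `t = dV 0`, plane `(a₁, a₂)`), a
W-unit `ε`, and a form congruence `T₀` of `diag dV` with `a • Φ₃` which is BLOCK-ADAPTED (`T₀ 0 0 = 0 = T₀ 0 2` and the torus law (i) of ★ p837182
`exists_blockAdaptedCongr`: `d(1, β, 1) ↦ β ⊕ 1₂`), the unnormalised Jacquet module `r_N(Ω)` of `Ω := ω_v ∘ ch_{T₀}` (`ω_v` the local Weil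
representation of the CM package ★ `chiLocalSplittingsCM` at the pair enumerated by `e_std = Equiv.prodUnique (Fin 3) (Fin 1)`, `ch_{T₀} = localLineInl ∘
localPiEquiv⁻¹ ∘ cmDatumLocalCongr T₀`, `N` the unipotent radical of ★ `cmBorelTriple L 3 v`) is identified with `𝒮(L⁺_v)` so that `d(1, β, 1)` acts as the
rank-one Weil operator `ω¹_{(t),ε}(β)` = ★ `lineWeilCM L (Equiv.prodUnique (Fin 1) (Fin 1)) (fun _ => dV 0) … μ hμ ε v u` (`β = det u`):
**`exists_lineJacquet_intertwiner_blockFrame`** — the (N′) hypothesis of ★ p837961 `F0P2oN3OfLineJacquet.thetaType_nonsplit_jacquetModule_of_lineJacquet`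
AT THE BLOCK FRAME with the V-line `(t)`; **`exists_lineJacquet_intertwiner_blockFrame_kernelLineCM`** — the same with the letter's line
`kernelLineCM dV` at any `e₀`, when `t = d · N(y)` (ONE application of the line matching (LM) ★ p836568).

ROUTE (lead B-p18 (g29) 23:35:17Z).  (1) chart ★ p835408 `exists_chart_of_nonsplit` `(u, a₀, Γ, Ψ, s′, φ₀)`; by (vi) + ★ `coinvariantsKer_restrict_eq`
`ker [·] = Ψ⁻¹(ker φ₀) = ker (φ₀ ∘ Ψ)` and `φ₀` is onto ((v): the fibre of `f ⊗ 1`), so ★ `exists_linearEquiv_comp_eq` gives `π̄ : r_N(Ω) ≃ₗ 𝒮(F¹)` with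
`π̄ [f] = φ₀ (Ψ f)` (★ `surjective_of_fibre_formula`, F0P2-p02 (g7)).  (2) (C4) ★ `exists_fibre_boxSB_eq_smul_blockFrame`: `φ₀ (Ψ (f_l ⊠ f_p)) = c(f_p) • Ψ₁ f_l` for an intertwiner `Ψ₁` of the line's
Schrödinger model.  (3) the torus on boxes (§1): `Ω (d(1,β,1)) (f_l ⊠ f_p) = (ω¹(β) f_l) ⊠ f_p` — A-p01 ★ `chiLocalSplittingsCM_s_eq_localSplittingCM` ∘ (BF)(i)
∘ ★ `localPiEquiv_symm_eq_inlLoc` ∘ ★ `localLineInl_prodUnique_inlLoc_blockFrame` ((β) B-p08 (g25); `(g₁ ⊕ 1) ⊗ 1 = (g₁ ⊗ 1) ⊕ 1`) ∘ (LS) ★ `DoubledBlock.toRep_localSplittingCMWith_inlLoc_boxSB_of_eq` (with (BD) ★ `gram_prodUnique_realDiagonal_eq_finSum`) ∘ ★ `localLineInl_localCenter`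
∘ A-p01 ★ `lineSplittingsCM_s_eq_localSplittingCM`.  (4) `Tr := Ψ₁⁻¹ ∘ π̄`: on boxes `Tr [Ω t (f_l ⊠ f_p)] = c • ω¹(β) f_l = ω¹(β) (Tr [f_l ⊠ f_p])`; boxes
span (★ `linearMap_ext_boxSB`) and `[·]` is onto.  (5) (LM).
[Kudla1986, Thm. 2.8; MoeglinVignerasWaldspurger1987, Chap. 3 §IV.2, §IV.5; GelbartRogawski1991, §3.2 (3.2.1)–(3.2.3) p. 457; Kudla1984, §1.]

## References
* [GelbartRogawski1991] S. Gelbart, J. Rogawski, *L-functions and Fourier–Jacobi coefficients for the unitary group U(3)*, Invent. Math. 105 (1991): §3.2 (3.2.1)–(3.2.3) p. 457.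
* [Kudla1986] S. Kudla, *On the local theta-correspondence*, Invent. Math. 83 (1986): Thm. 2.8.
* [Kudla1984] S. Kudla, *Seesaw dual reductive pairs*, Progr. Math. 46 (1984): §1.
* [MoeglinVignerasWaldspurger1987] C. Mœglin, M.-F. Vignéras, J.-L. Waldspurger, LNM 1291 (1987): Chap. 2 II.1 Rem. (6); Chap. 3 §IV.2, §IV.5.
-/

set_option autoImplicit false
set_option linter.dupNamespace false -- the mandated namespace repeats the single-problem summit's segment

noncomputable section

open scoped Matrix MatrixGroups Kronecker
open _root_.Matrix NumberField IsDedekindDomain MeasureTheory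
open Literature.NumberTheory Literature.NumberTheory.Automorphic Literature.NumberTheory.Automorphic.UnitaryGroup
open Literature.NumberTheory.Automorphic.IdeleClassGroup
open Literature.NumberTheory.Automorphic.UnitaryGroup.QuadraticCoordinates Literature.NumberTheory.Automorphic.UnitaryGroup.IsQuadraticCoordinates
open Literature.NumberTheory.Automorphic.Liu2021 Literature.NumberTheory.Automorphic.Liu2021.Def411WeilCarriers
open Literature.NumberTheory.GelbartRogawski1991 Literature.NumberTheory.GelbartRogawski1991.UnitaryDualPair
open Literature.NumberTheory.GelbartRogawski1991.UnitaryDualPair.LocalSplitting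
open Literature.RepresentationTheory Literature.RepresentationTheory.HeisenbergGroup Literature.RepresentationTheory.Liu2021
open Literature.NumberTheory.GaloisRepresentations Literature.NumberTheory.Rogawski1990
open Literature.NumberTheory.Automorphic.Liu2021.Def411WeilCarriersDoubling Literature.NumberTheory.GelbartRogawski1991.UnitaryDualPair.WeilCoinv
open Summit.HodgeConjecture.HodgeConjecture.Cruxes.H413.F0P2oBlockAdaptedCongruence
open Summit.HodgeConjecture.HodgeConjecture.Cruxes.H413.F0P2oLineWeilDictionaryFrameTransportOfRecord
open Summit.HodgeConjecture.HodgeConjecture.Cruxes.H413.F0P2oN3TorusWeightOfD3d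

namespace Summit.HodgeConjecture.HodgeConjecture.Cruxes.H413.F0P2oLineJacquetAtBlockFrame

variable (L : Type) [Field L] [NumberField L] [IsCMField L]

/-! ## §1 The torus `d(1, β, 1)` acts on boxes by the rank-one Weil operator on the line factor -/

section Torus

variable (dV : Fin 3 → L) (hdV : ∀ i, IsCMField.complexConj L (dV i) = dV i) (hdV0 : ∀ i, dV i ≠ 0) (ε : (↥(maximalRealSubfield L))ˣ)
  (v : HeightOneSpectrum (𝓞 ↥(maximalRealSubfield L)))

/-- **the centre embedded in the V-line has the matrix of `u`**: for `u ∈ U((ε))(L⁺_v) = E¹_v`, the `1 × 1` unitary `localCenter u ∈ U((dV 0))(L⁺_v)` (the scalar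
`det u · 1₁`) has, over `S = L ⊗ L⁺_v`, the same matrix as `u`. [cite: Mok2014, §1 Notation p. 5] -/
theorem coe_localPiEquiv_localCenter_one (u : localPi L (IsCMField.complexConj L) 1 (JW (↥(maximalRealSubfield L)) L ε) v) :
    ((localPiEquiv L (IsCMField.complexConj L) 1 (Matrix.diagonal fun _ : Fin 1 => dV 0) v
        (localCenter L (IsCMField.complexConj L) 1 (Matrix.diagonal fun _ : Fin 1 => dV 0) (JW (↥(maximalRealSubfield L)) L ε)
          (JW_apply_ne_zero (↥(maximalRealSubfield L)) L ε) v u) :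
        «local» L (IsCMField.complexConj L) 1 (Matrix.diagonal fun _ : Fin 1 => dV 0) v) : GL (Fin 1) (UnitaryGroup.LocalRing L v)) =
      ((localPiEquiv L (IsCMField.complexConj L) 1 (JW (↥(maximalRealSubfield L)) L ε) v u :
        «local» L (IsCMField.complexConj L) 1 (JW (↥(maximalRealSubfield L)) L ε) v) : GL (Fin 1) (UnitaryGroup.LocalRing L v)) := by
  have hc : ((localCenter L (IsCMField.complexConj L) 1 (Matrix.diagonal fun _ : Fin 1 => dV 0) (JW (↥(maximalRealSubfield L)) L ε)
      (JW_apply_ne_zero (↥(maximalRealSubfield L)) L ε) v u : localPi L (IsCMField.complexConj L) 1 (Matrix.diagonal fun _ : Fin 1 => dV 0) v) :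
        LocalGLPi L 1 v) = (u : LocalGLPi L 1 v) := by
    rw [coe_localCenter]
    refine funext fun w => Units.ext ?_
    rw [coe_localScalarGL_apply]
    ext i j
    rw [Subsingleton.elim i 0, Subsingleton.elim j 0, Matrix.smul_apply, Matrix.one_apply_eq, smul_eq_mul, mul_one]
  rw [coe_localPiEquiv_apply, coe_localPiEquiv_apply, hc]

/-- **the entry of `localCenter u` is `det u`** (`1 × 1`: ★ `glDiagonal_localDet_eq_localPiEquiv`). [cite: Rogawski1990, §3.13] -/
theorem localPiEquiv_localCenter_one_apply (u : localPi L (IsCMField.complexConj L) 1 (JW (↥(maximalRealSubfield L)) L ε) v) :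
    (((localPiEquiv L (IsCMField.complexConj L) 1 (Matrix.diagonal fun _ : Fin 1 => dV 0) v
        (localCenter L (IsCMField.complexConj L) 1 (Matrix.diagonal fun _ : Fin 1 => dV 0) (JW (↥(maximalRealSubfield L)) L ε)
          (JW_apply_ne_zero (↥(maximalRealSubfield L)) L ε) v u) :
        «local» L (IsCMField.complexConj L) 1 (Matrix.diagonal fun _ : Fin 1 => dV 0) v) : GL (Fin 1) (UnitaryGroup.LocalRing L v)) :
        Matrix (Fin 1) (Fin 1) (UnitaryGroup.LocalRing L v)) 0 0 =
      (((localDet (IsCMField.complexConj L) v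
        (isUnit_iff_ne_zero.mpr (by rw [Matrix.det_fin_one]; exact JW_apply_ne_zero (↥(maximalRealSubfield L)) L ε))
        (localPiEquiv L (IsCMField.complexConj L) 1 (JW (↥(maximalRealSubfield L)) L ε) v u) :
          ↥(normOneUnits (conjLocal L (IsCMField.complexConj L) v))) : (UnitaryGroup.LocalRing L v)ˣ) : UnitaryGroup.LocalRing L v) := by
  rw [coe_localPiEquiv_localCenter_one, coe_coe_localDet, Matrix.det_fin_one]

variable (μ : Literature.NumberTheory.Automorphic.IdeleClassGroup L →ₜ* Circle) (hμ : IsConjugateSymplectic L μ)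
  (T₀ : GL (Fin 3) (UnitaryGroup.LocalRing L v))
  (h₀ : formCongr (conjLocal L (IsCMField.complexConj L) v) T₀ ((Matrix.diagonal dV).map (algebraMap L (UnitaryGroup.LocalRing L v))) =
    algebraMap L (UnitaryGroup.LocalRing L v) (dV 0) •
      (Matrix.of fun i j : Fin 3 => if i.val + j.val + 1 = 3 then (1 : L) else 0).map (algebraMap L (UnitaryGroup.LocalRing L v)))
  (hinl : ∀ (τ : ↥(cmBorelTriple L 3 v).M)
      (τ₁ : ↥(UnitaryGroup.«local» L (IsCMField.complexConj L) 1 (Matrix.diagonal fun _ : Fin 1 => dV 0) v)),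
    torusEntry (conjLocal L (IsCMField.complexConj L) v) (cmLocalForm L 3 v) 0 τ = 1 →
    (τ₁ : GL (Fin 1) (UnitaryGroup.LocalRing L v)).val 0 0 =
      ((torusEntry (conjLocal L (IsCMField.complexConj L) v) (cmLocalForm L 3 v) 1 τ : (UnitaryGroup.LocalRing L v)ˣ) :
        UnitaryGroup.LocalRing L v) →
    cmDatumLocalCongr L v T₀ ((hdV0 0).isUnit.map (algebraMap L (UnitaryGroup.LocalRing L v))) h₀
        (τ : ↥(unitaryGroupOfForm (conjLocal L (IsCMField.complexConj L) v) (cmLocalForm L 3 v))) =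
      BlockSum.inlLocal (↥(maximalRealSubfield L)) L (IsCMField.complexConj L) v 1 2
        (realDiagonal_map L (fun _ : Fin 1 => dV 0) (fun _ => hdV 0)).symm (diagonal_eq_finSum_realDiagonal_map L dV hdV) τ₁)

include hinl in
set_option synthInstance.maxHeartbeats 400000 in
set_option maxHeartbeats 16000000 in
/-- **THE TORUS ON BOXES**: at a block-adapted congruence `T₀` ((BF)(i): `d(1, β, 1) ↦ β ⊕ 1₂`), the pulled-back Weil representation
`Ω = ω_v ∘ ch_{T₀}` of the CM package acts on a box `f_l ⊠ f_p` (`⊠ = boxSB F finSumFinEquiv`, line factor FIRST) through `d(1, β, 1)` by the rank-one Weil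
operator on the line factor: `Ω (d(1,β,1)) (f_l ⊠ f_p) = (ω¹_{(dV 0),ε}(u) f_l) ⊠ f_p` (`β = det u`, `ω¹ = ★ lineWeilCM … (fun _ => dV 0) … u`) — (LS) ★
`DoubledBlock.toRep_localSplittingCMWith_inlLoc_boxSB_of_eq` (with (β)∕(BD) ★ `gram_prodUnique_realDiagonal_eq_finSum`) after (BF)(i), ★ `localPiEquiv_symm_eq_inlLoc`,
★ `localLineInl_prodUnique_inlLoc_blockFrame` (`(g₁ ⊕ 1) ⊗ 1 = (g₁ ⊗ 1) ⊕ 1`) and ★ `localLineInl_localCenter`, with A-p01's ★ bridges to `localSplittingCM`.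
[cite: Kudla1984, §1] [cite: GelbartRogawski1991, §3.2 (3.2.1) p. 457] [cite: MoeglinVignerasWaldspurger1987, Chap. 2 II.1 Rem. (6)] -/
theorem omega_ch_torus_boxSB (u : localPi L (IsCMField.complexConj L) 1 (JW (↥(maximalRealSubfield L)) L ε) v) (t : ↥(cmBorelTriple L 3 v).M)
    (ht : glDiagonal 3 (UnitaryGroup.LocalRing L v) ![1, ((localDet (IsCMField.complexConj L) v
        (isUnit_iff_ne_zero.mpr (by rw [Matrix.det_fin_one]; exact JW_apply_ne_zero (↥(maximalRealSubfield L)) L ε))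
        (localPiEquiv L (IsCMField.complexConj L) 1 (JW (↥(maximalRealSubfield L)) L ε) v u) :
          ↥(normOneUnits (conjLocal L (IsCMField.complexConj L) v))) : (UnitaryGroup.LocalRing L v)ˣ), 1] =
      ((t : ↥(unitaryGroupOfForm (conjLocal L (IsCMField.complexConj L) v) (cmLocalForm L 3 v))) : GL (Fin 3) (UnitaryGroup.LocalRing L v)))
    (f_l : SchwartzBruhat (Fin 1 → v.adicCompletion ↥(maximalRealSubfield L))) (f_p : SchwartzBruhat (Fin 2 → v.adicCompletion ↥(maximalRealSubfield L))) :
    (((chiLocalSplittingsCM L (Equiv.prodUnique (Fin 3) (Fin 1)) dV hdV hdV0 (toHeckeCharacter L μ) ((isOscillatorChar_toHeckeCharacter_iff μ).mpr hμ) ε).omegaLoc v).comp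
        ((localLineInl L (IsCMField.complexConj L) 3 (Equiv.prodUnique (Fin 3) (Fin 1)) (Matrix.diagonal dV) (JW (↥(maximalRealSubfield L)) L ε) v).comp
          ((localPiEquiv L (IsCMField.complexConj L) 3 (Matrix.diagonal dV) v).symm.toMonoidHom.comp
            (cmDatumLocalCongr L v T₀ ((hdV0 0).isUnit.map (algebraMap L (UnitaryGroup.LocalRing L v))) h₀).toMonoidHom)))
        (t : ↥(unitaryGroupOfForm (conjLocal L (IsCMField.complexConj L) v) (cmLocalForm L 3 v)))
        (boxSB (v.adicCompletion ↥(maximalRealSubfield L)) (finSumFinEquiv : Fin 1 ⊕ Fin 2 ≃ Fin 3) f_l f_p) =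
      boxSB (v.adicCompletion ↥(maximalRealSubfield L)) (finSumFinEquiv : Fin 1 ⊕ Fin 2 ≃ Fin 3)
        (lineWeilCM L (Equiv.prodUnique (Fin 1) (Fin 1)) (fun _ : Fin 1 => dV 0) (fun _ => hdV 0) (fun _ => hdV0 0) μ hμ ε v u f_l) f_p := by
  classical
  -- the line element `g₁ = det u · 1₁ ∈ U((dV 0))(L⁺_v)` and its matrix form `τ₁`
  set g₁ := localCenter L (IsCMField.complexConj L) 1 (Matrix.diagonal fun _ : Fin 1 => dV 0) (JW (↥(maximalRealSubfield L)) L ε)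
    (JW_apply_ne_zero (↥(maximalRealSubfield L)) L ε) v u with hg₁
  -- (BF)(i): `ch_{T₀} t = τ₁ ⊕ 1₂`
  have h0 : torusEntry (conjLocal L (IsCMField.complexConj L) v) (cmLocalForm L 3 v) 0 t = 1 := by
    rw [torusEntry_eq_of_glDiagonal_eq (conjLocal L (IsCMField.complexConj L) v) (cmLocalForm L 3 v) 0 t _ ht]; rfl
  have h1 : ((localPiEquiv L (IsCMField.complexConj L) 1 (Matrix.diagonal fun _ : Fin 1 => dV 0) v g₁ :
      «local» L (IsCMField.complexConj L) 1 (Matrix.diagonal fun _ : Fin 1 => dV 0) v) : GL (Fin 1) (UnitaryGroup.LocalRing L v)).val 0 0 =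
      ((torusEntry (conjLocal L (IsCMField.complexConj L) v) (cmLocalForm L 3 v) 1 t : (UnitaryGroup.LocalRing L v)ˣ) : UnitaryGroup.LocalRing L v) := by
    rw [torusEntry_eq_of_glDiagonal_eq (conjLocal L (IsCMField.complexConj L) v) (cmLocalForm L 3 v) 1 t _ ht, hg₁]
    exact localPiEquiv_localCenter_one_apply L dV ε v u
  have hτ := hinl t (localPiEquiv L (IsCMField.complexConj L) 1 (Matrix.diagonal fun _ : Fin 1 => dV 0) v g₁) h0 h1
  -- `ch_{T₀} t = (g₁ ⊗ 1) ⊕ 1₂` on the pair side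
  have hch : localLineInl L (IsCMField.complexConj L) 3 (Equiv.prodUnique (Fin 3) (Fin 1)) (Matrix.diagonal dV) (JW (↥(maximalRealSubfield L)) L ε) v
      ((localPiEquiv L (IsCMField.complexConj L) 3 (Matrix.diagonal dV) v).symm
        (cmDatumLocalCongr L v T₀ ((hdV0 0).isUnit.map (algebraMap L (UnitaryGroup.LocalRing L v))) h₀
          (t : ↥(unitaryGroupOfForm (conjLocal L (IsCMField.complexConj L) v) (cmLocalForm L 3 v))))) =
      BlockSum.inlLoc (↥(maximalRealSubfield L)) L (IsCMField.complexConj L) v 1 2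
        (F0P2oCMBlockFrameGram.reindex_prodUnique_kronecker_one_eq_gram_map L dV hdV ε)
        (F0P2oCMBlockFrameGram.reindex_prodUnique_kronecker_three_eq_finSum_map L dV hdV ε)
        (localLineInl L (IsCMField.complexConj L) 1 (Equiv.prodUnique (Fin 1) (Fin 1)) (Matrix.diagonal fun _ : Fin 1 => dV 0)
          (JW (↥(maximalRealSubfield L)) L ε) v g₁) := by
    have h2 : (localPiEquiv L (IsCMField.complexConj L) 3 (Matrix.diagonal dV) v).symm
        (cmDatumLocalCongr L v T₀ ((hdV0 0).isUnit.map (algebraMap L (UnitaryGroup.LocalRing L v))) h₀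
          (t : ↥(unitaryGroupOfForm (conjLocal L (IsCMField.complexConj L) v) (cmLocalForm L 3 v)))) =
        BlockSum.inlLoc (↥(maximalRealSubfield L)) L (IsCMField.complexConj L) v 1 2
          (realDiagonal_map L (fun _ : Fin 1 => dV 0) (fun _ => hdV 0)).symm (diagonal_eq_finSum_realDiagonal_map L dV hdV)
          ((localPiEquiv L (IsCMField.complexConj L) 1 (Matrix.diagonal fun _ : Fin 1 => dV 0) v).symm
            (localPiEquiv L (IsCMField.complexConj L) 1 (Matrix.diagonal fun _ : Fin 1 => dV 0) v g₁)) :=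
      localPiEquiv_symm_eq_inlLoc _ _ _ _ hτ
    rw [h2, ContinuousMulEquiv.symm_apply_apply]
    exact F0P2oCMBlockFrameGram.localLineInl_prodUnique_inlLoc_blockFrame L v dV hdV ε g₁
  -- unfold `Ω` on the box and move to `localSplittingCM`
  show MpPsi.toRep (localSchrodinger (↥(maximalRealSubfield L)) 3
      (gram (↥(maximalRealSubfield L)) (Equiv.prodUnique (Fin 3) (Fin 1)) (realDiagonal L dV hdV) (TW (↥(maximalRealSubfield L)) ε)) v)
      (((chiLocalSplittingsCM L (Equiv.prodUnique (Fin 3) (Fin 1)) dV hdV hdV0 (toHeckeCharacter L μ)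
        ((isOscillatorChar_toHeckeCharacter_iff μ).mpr hμ) ε).s v)
        (localLineInl L (IsCMField.complexConj L) 3 (Equiv.prodUnique (Fin 3) (Fin 1)) (Matrix.diagonal dV) (JW (↥(maximalRealSubfield L)) L ε) v
          ((localPiEquiv L (IsCMField.complexConj L) 3 (Matrix.diagonal dV) v).symm
            (cmDatumLocalCongr L v T₀ ((hdV0 0).isUnit.map (algebraMap L (UnitaryGroup.LocalRing L v))) h₀
              (t : ↥(unitaryGroupOfForm (conjLocal L (IsCMField.complexConj L) v) (cmLocalForm L 3 v)))))))
      (boxSB (v.adicCompletion ↥(maximalRealSubfield L)) (finSumFinEquiv : Fin 1 ⊕ Fin 2 ≃ Fin 3) f_l f_p) = _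
  rw [hch, chiLocalSplittingsCM_s_eq_localSplittingCM]
  -- the local see-saw (LS), Borel σ-algebra and `addHaar` as inside ★ `localSplittingCM`
  letI : MeasurableSpace (v.adicCompletion ↥(maximalRealSubfield L)) := borel _
  haveI : BorelSpace (v.adicCompletion ↥(maximalRealSubfield L)) := ⟨rfl⟩
  have hT₁t : gram (↥(maximalRealSubfield L)) (Equiv.prodUnique (Fin 1) (Fin 1)) (realDiagonal L (fun _ : Fin 1 => dV 0) (fun _ => hdV 0))
      (TW (↥(maximalRealSubfield L)) ε) = Matrix.diagonal fun _ : Fin 1 =>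
        gram (↥(maximalRealSubfield L)) (Equiv.prodUnique (Fin 1) (Fin 1)) (realDiagonal L (fun _ : Fin 1 => dV 0) (fun _ => hdV 0))
          (TW (↥(maximalRealSubfield L)) ε) 0 0 := by
    ext i j
    rw [Subsingleton.elim i 0, Subsingleton.elim j 0, Matrix.diagonal_apply_eq]
  have hLS := DoubledBlock.toRep_localSplittingCMWith_inlLoc_boxSB_of_eq L v Measure.addHaar 1 2
    (isSymm_gram (↥(maximalRealSubfield L)) (Equiv.prodUnique (Fin 1) (Fin 1)) (realDiagonal_isSymm L (fun _ : Fin 1 => dV 0) (fun _ => hdV 0))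
      (isSymm_TW (↥(maximalRealSubfield L)) ε))
    (isSymm_gram (↥(maximalRealSubfield L)) (Equiv.prodUnique (Fin 2) (Fin 1)) (realDiagonal_isSymm L (fun k : Fin 2 => dV k.succ) (fun k => hdV k.succ))
      (isSymm_TW (↥(maximalRealSubfield L)) ε))
    (isUnit_det_gram (↥(maximalRealSubfield L)) (Equiv.prodUnique (Fin 1) (Fin 1))
      (isUnit_det_realDiagonal L (fun _ : Fin 1 => dV 0) (fun _ => hdV 0) (fun _ => hdV0 0)) (isUnit_det_TW (↥(maximalRealSubfield L)) ε))
    (isUnit_det_gram (↥(maximalRealSubfield L)) (Equiv.prodUnique (Fin 2) (Fin 1))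
      (isUnit_det_realDiagonal L (fun k : Fin 2 => dV k.succ) (fun k => hdV k.succ) (fun k => hdV0 k.succ)) (isUnit_det_TW (↥(maximalRealSubfield L)) ε))
    (reindex_kronecker_eq_gram_map (↥(maximalRealSubfield L)) L (Equiv.prodUnique (Fin 1) (Fin 1))
      (realDiagonal_map L (fun _ : Fin 1 => dV 0) (fun _ => hdV 0)).symm (JW_eq (↥(maximalRealSubfield L)) L ε))
    (toHeckeCharacter L μ) ((isOscillatorChar_toHeckeCharacter_iff μ).mpr hμ) (F0P2oCMBlockFrameGram.gram_prodUnique_realDiagonal_eq_finSum L dV hdV ε)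
    (isSymm_gram (↥(maximalRealSubfield L)) (Equiv.prodUnique (Fin 3) (Fin 1)) (realDiagonal_isSymm L dV hdV) (isSymm_TW (↥(maximalRealSubfield L)) ε))
    (isUnit_det_gram (↥(maximalRealSubfield L)) (Equiv.prodUnique (Fin 3) (Fin 1)) (isUnit_det_realDiagonal L dV hdV hdV0) (isUnit_det_TW (↥(maximalRealSubfield L)) ε))
    (reindex_kronecker_eq_gram_map (↥(maximalRealSubfield L)) L (Equiv.prodUnique (Fin 3) (Fin 1)) (realDiagonal_map L dV hdV).symm (JW_eq (↥(maximalRealSubfield L)) L ε))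
    one_pos _ hT₁t
    (localLineInl L (IsCMField.complexConj L) 1 (Equiv.prodUnique (Fin 1) (Fin 1)) (Matrix.diagonal fun _ : Fin 1 => dV 0)
      (JW (↥(maximalRealSubfield L)) L ε) v g₁) f_l f_p
  refine hLS.trans ?_
  -- the line factor: `localLineInl₁ (localCenter₁ u) = localCenter u` in the line pair, and the line package of record IS `localSplittingCM`
  congr 1
  rw [hg₁, localLineInl_localCenter]
  show _ = MpPsi.toRep (localSchrodinger (↥(maximalRealSubfield L)) 1
      (gram (↥(maximalRealSubfield L)) (Equiv.prodUnique (Fin 1) (Fin 1)) (realDiagonal L (fun _ : Fin 1 => dV 0) (fun _ => hdV 0))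
        (TW (↥(maximalRealSubfield L)) ε)) v)
      (((lineSplittingsCM L (Equiv.prodUnique (Fin 1) (Fin 1)) (fun _ : Fin 1 => dV 0) (fun _ => hdV 0) (fun _ => hdV0 0) (toHeckeCharacter L μ)
        ((isOscillatorChar_toHeckeCharacter_iff μ).mpr hμ) ε).s v)
        (localCenter L (IsCMField.complexConj L) 1
          (Matrix.reindex (Equiv.prodUnique (Fin 1) (Fin 1)) (Equiv.prodUnique (Fin 1) (Fin 1))
            ((Matrix.diagonal fun _ : Fin 1 => dV 0) ⊗ₖ JW (↥(maximalRealSubfield L)) L ε))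
          (JW (↥(maximalRealSubfield L)) L ε) (JW_apply_ne_zero (↥(maximalRealSubfield L)) L ε) v u)) f_l
  rw [lineSplittingsCM_s_eq_localSplittingCM]
  rfl

end Torus

/-! ## §2 (C5): the line-Jacquet intertwiner at the block frame -/

section Head

variable (dV : Fin 3 → L) (hdV : ∀ i, IsCMField.complexConj L (dV i) = dV i) (hdV0 : ∀ i, dV i ≠ 0)
  (μ : Literature.NumberTheory.Automorphic.IdeleClassGroup L →ₜ* Circle) (hμ : IsConjugateSymplectic L μ)
  (v : HeightOneSpectrum (𝓞 ↥(maximalRealSubfield L))) (hv : ∀ w : PlacesOver L v, IsCMField.complexConj L • w.1 = w.1)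
  (ε : (↥(maximalRealSubfield L))ˣ)
  (T₀ : GL (Fin 3) (UnitaryGroup.LocalRing L v))
  (h₀ : formCongr (conjLocal L (IsCMField.complexConj L) v) T₀ ((Matrix.diagonal dV).map (algebraMap L (UnitaryGroup.LocalRing L v))) =
    algebraMap L (UnitaryGroup.LocalRing L v) (dV 0) •
      (Matrix.of fun i j : Fin 3 => if i.val + j.val + 1 = 3 then (1 : L) else 0).map (algebraMap L (UnitaryGroup.LocalRing L v)))
  (h00 : (T₀ : Matrix (Fin 3) (Fin 3) (UnitaryGroup.LocalRing L v)) 0 0 = 0)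
  (h02 : (T₀ : Matrix (Fin 3) (Fin 3) (UnitaryGroup.LocalRing L v)) 0 2 = 0)
  (hinl : ∀ (τ : ↥(cmBorelTriple L 3 v).M)
      (τ₁ : ↥(UnitaryGroup.«local» L (IsCMField.complexConj L) 1 (Matrix.diagonal fun _ : Fin 1 => dV 0) v)),
    torusEntry (conjLocal L (IsCMField.complexConj L) v) (cmLocalForm L 3 v) 0 τ = 1 →
    (τ₁ : GL (Fin 1) (UnitaryGroup.LocalRing L v)).val 0 0 =
      ((torusEntry (conjLocal L (IsCMField.complexConj L) v) (cmLocalForm L 3 v) 1 τ : (UnitaryGroup.LocalRing L v)ˣ) :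
        UnitaryGroup.LocalRing L v) →
    cmDatumLocalCongr L v T₀ ((hdV0 0).isUnit.map (algebraMap L (UnitaryGroup.LocalRing L v))) h₀
        (τ : ↥(unitaryGroupOfForm (conjLocal L (IsCMField.complexConj L) v) (cmLocalForm L 3 v))) =
      BlockSum.inlLocal (↥(maximalRealSubfield L)) L (IsCMField.complexConj L) v 1 2
        (realDiagonal_map L (fun _ : Fin 1 => dV 0) (fun _ => hdV 0)).symm (diagonal_eq_finSum_realDiagonal_map L dV hdV) τ₁)

include hv h00 h02 hinl in
set_option synthInstance.maxHeartbeats 400000 in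
set_option maxHeartbeats 32000000 in
/-- **(C5) «(N′) AT THE BLOCK FRAME» — THE LINE-JACQUET INTERTWINER.**  At a finite place `v` of `L⁺` NON-SPLIT in `L`, for a real non-zero diagonal `dV`
(line `dV 0`, plane `(dV 1, dV 2)`), a W-unit `ε`, a conjugate-symplectic `μ`, and a BLOCK-ADAPTED form congruence `T₀` of `diag dV` with `ι(dV 0) • Φ₃`
(`T₀ 0 0 = 0 = T₀ 0 2` and the torus law (i) of ★ `exists_blockAdaptedCongr`, taken as the hypothesis `hinl`): there is a linear isomorphism
`Tr : r_N(Ω) ≃ₗ[ℂ] 𝒮(L⁺_v)` of the unnormalised Jacquet module of `Ω := ω_v ∘ ch_{T₀}` (★ `chiLocalSplittingsCM` at `e_std`, ★ `cmBorelTriple L 3 v`) such that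
for every `u ∈ U((ε))(L⁺_v)` and every torus element `t = d(1, det u, 1)`, `Tr ∘ r_N(Ω)(t) = ω¹(u) ∘ Tr` with `ω¹ = ★ lineWeilCM L (Equiv.prodUnique (Fin 1) (Fin 1))
(fun _ => dV 0) … μ hμ ε v` — the (N′) hypothesis `hL` of ★ `F0P2oN3OfLineJacquet.thetaType_nonsplit_jacquetModule_of_lineJacquet` AT THE BLOCK FRAME, V-line `(dV 0)`
(the hop to the letter's `kernelLineCM dV` at the letter's `e₀` is (C5c′): ★ (J1) + ★ (LM) + ★ (KL), downstream).  `Tr := Ψ₁⁻¹ ∘ π̄` with `π̄ [f] = φ₀ (Ψ f)` the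
Jacquet chart of ★ p835408 ((v)(vi), ★ `surjective_of_fibre_formula`, ★ `exists_linearEquiv_comp_eq`) and `Ψ₁` from (C4) ★ `exists_fibre_boxSB_eq_smul_blockFrame`;
on boxes §1 `omega_ch_torus_boxSB`, boxes span (★ `linearMap_ext_boxSB`).
[cite: GelbartRogawski1991, §3.2 (3.2.1)–(3.2.3) p. 457] [cite: Kudla1986, Thm. 2.8] [cite: MoeglinVignerasWaldspurger1987, Chap. 3 §IV.2, §IV.5] [cite: Kudla1984, §1] -/
theorem exists_lineJacquet_intertwiner_blockFrame :
    ∃ Tr : ((cmBorelTriple L 3 v).restrict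
        (((chiLocalSplittingsCM L (Equiv.prodUnique (Fin 3) (Fin 1)) dV hdV hdV0 (toHeckeCharacter L μ) ((isOscillatorChar_toHeckeCharacter_iff μ).mpr hμ) ε).omegaLoc v).comp
          ((localLineInl L (IsCMField.complexConj L) 3 (Equiv.prodUnique (Fin 3) (Fin 1)) (Matrix.diagonal dV) (JW (↥(maximalRealSubfield L)) L ε) v).comp
            ((localPiEquiv L (IsCMField.complexConj L) 3 (Matrix.diagonal dV) v).symm.toMonoidHom.comp
              (cmDatumLocalCongr L v T₀ ((hdV0 0).isUnit.map (algebraMap L (UnitaryGroup.LocalRing L v))) h₀).toMonoidHom)))).Coinvariants ≃ₗ[ℂ]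
        SchwartzBruhat (Fin 1 → v.adicCompletion ↥(maximalRealSubfield L)),
      ∀ (u : localPi L (IsCMField.complexConj L) 1 (JW (↥(maximalRealSubfield L)) L ε) v) (t : ↥(cmBorelTriple L 3 v).M),
        glDiagonal 3 (LocalRing L v) ![1, ((localDet (IsCMField.complexConj L) v
          (isUnit_iff_ne_zero.mpr (by rw [Matrix.det_fin_one]; exact JW_apply_ne_zero (↥(maximalRealSubfield L)) L ε))
          (localPiEquiv L (IsCMField.complexConj L) 1 (JW (↥(maximalRealSubfield L)) L ε) v u) :
            ↥(normOneUnits (conjLocal L (IsCMField.complexConj L) v))) : (LocalRing L v)ˣ), 1] =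
          ((t : ↥(unitaryGroupOfForm (conjLocal L (IsCMField.complexConj L) v) (cmLocalForm L 3 v))) : GL (Fin 3) (LocalRing L v)) →
        ∀ x, Tr (Representation.jacquetModule
          (((chiLocalSplittingsCM L (Equiv.prodUnique (Fin 3) (Fin 1)) dV hdV hdV0 (toHeckeCharacter L μ) ((isOscillatorChar_toHeckeCharacter_iff μ).mpr hμ) ε).omegaLoc v).comp
            ((localLineInl L (IsCMField.complexConj L) 3 (Equiv.prodUnique (Fin 3) (Fin 1)) (Matrix.diagonal dV) (JW (↥(maximalRealSubfield L)) L ε) v).comp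
              ((localPiEquiv L (IsCMField.complexConj L) 3 (Matrix.diagonal dV) v).symm.toMonoidHom.comp
                (cmDatumLocalCongr L v T₀ ((hdV0 0).isUnit.map (algebraMap L (UnitaryGroup.LocalRing L v))) h₀).toMonoidHom)))
          (cmBorelTriple L 3 v) t x) =
          lineWeilCM L (Equiv.prodUnique (Fin 1) (Fin 1)) (fun _ : Fin 1 => dV 0) (fun _ => hdV 0) (fun _ => hdV0 0) μ hμ ε v u (Tr x) := by
  classical
  -- (1) the chart of ★ p835408 at `(e_std, dV, T₀, ι(dV 0), h₀)` for the package of record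
  obtain ⟨uu, a₀, Γ, Ψ, s', φ₀, -, h0, hi, hib, hii, -, -, hv5, hvi⟩ :=
    F0P2oYCoinvariantsChartCM.exists_chart_of_nonsplit L (Equiv.prodUnique (Fin 3) (Fin 1)) dV hdV hdV0 ε v hv
      (chiLocalSplittingsCM L (Equiv.prodUnique (Fin 3) (Fin 1)) dV hdV hdV0 (toHeckeCharacter L μ) ((isOscillatorChar_toHeckeCharacter_iff μ).mpr hμ) ε)
      T₀ ((hdV0 0).isUnit.map (algebraMap L (UnitaryGroup.LocalRing L v))) h₀
  -- (2) the factorisation of the chart in the block frame, (C4)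
  obtain ⟨Γ₁, Ψ₁, -, -, -, hc⟩ := F0P2oBlockFrameChartFactorisation.exists_fibre_boxSB_eq_smul_blockFrame L dV hdV ε v _ _
    (isUnit_det_gram (↥(maximalRealSubfield L)) (Equiv.prodUnique (Fin 1) (Fin 1))
      (isUnit_det_realDiagonal L (fun _ : Fin 1 => dV 0) (fun _ => hdV 0) (fun _ => hdV0 0)) (isUnit_det_TW (↥(maximalRealSubfield L)) ε))
    (F0P2oCMBlockFrameGram.gram_prodUnique_realDiagonal_eq_finSum L dV hdV ε) T₀ h00 h02 uu a₀ Γ Ψ φ₀ h0 hi hib hii hv5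
  -- (3) the Jacquet chart `π̄ [f] = φ₀ (Ψ f)`
  have hsurj : Function.Surjective (φ₀ ∘ₗ (Ψ : SchwartzBruhat (Fin 3 → v.adicCompletion ↥(maximalRealSubfield L)) →ₗ[ℂ]
      SchwartzBruhat ((Fin 2 ⊕ Fin 1) → v.adicCompletion ↥(maximalRealSubfield L)))) :=
    (surjective_of_fibre_formula (v.adicCompletion ↥(maximalRealSubfield L)) φ₀ hv5).comp Ψ.surjective
  have hker : LinearMap.ker (Representation.Coinvariants.mk ((cmBorelTriple L 3 v).restrict
      (((chiLocalSplittingsCM L (Equiv.prodUnique (Fin 3) (Fin 1)) dV hdV hdV0 (toHeckeCharacter L μ) ((isOscillatorChar_toHeckeCharacter_iff μ).mpr hμ) ε).omegaLoc v).comp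
        ((localLineInl L (IsCMField.complexConj L) 3 (Equiv.prodUnique (Fin 3) (Fin 1)) (Matrix.diagonal dV) (JW (↥(maximalRealSubfield L)) L ε) v).comp
          ((localPiEquiv L (IsCMField.complexConj L) 3 (Matrix.diagonal dV) v).symm.toMonoidHom.comp
            (cmDatumLocalCongr L v T₀ ((hdV0 0).isUnit.map (algebraMap L (UnitaryGroup.LocalRing L v))) h₀).toMonoidHom))))) =
      LinearMap.ker (φ₀ ∘ₗ (Ψ : SchwartzBruhat (Fin 3 → v.adicCompletion ↥(maximalRealSubfield L)) →ₗ[ℂ]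
        SchwartzBruhat ((Fin 2 ⊕ Fin 1) → v.adicCompletion ↥(maximalRealSubfield L)))) := by
    rw [LinearMap.ker_comp]
    exact ((Submodule.ker_mkQ _).trans (coinvariantsKer_restrict_eq _ (cmBorelTriple L 3 v))).trans hvi
  obtain ⟨πbar, hπ⟩ := F0P2oJacquetChartUniqueness.exists_linearEquiv_comp_eq _ _ (Representation.Coinvariants.mk_surjective _) hsurj hker
  refine ⟨πbar.trans Ψ₁.symm, fun u t ht x => ?_⟩
  obtain ⟨f, rfl⟩ := Representation.Coinvariants.mk_surjective _ x
  rw [Representation.jacquetModule_mk]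
  -- (4) both sides are linear in `f` and agree on boxes (§1), and boxes span (★ `linearMap_ext_boxSB`)
  have hAB : (πbar.trans Ψ₁.symm).toLinearMap ∘ₗ
        (Representation.Coinvariants.mk _) ∘ₗ
        ((((chiLocalSplittingsCM L (Equiv.prodUnique (Fin 3) (Fin 1)) dV hdV hdV0 (toHeckeCharacter L μ) ((isOscillatorChar_toHeckeCharacter_iff μ).mpr hμ) ε).omegaLoc v).comp
          ((localLineInl L (IsCMField.complexConj L) 3 (Equiv.prodUnique (Fin 3) (Fin 1)) (Matrix.diagonal dV) (JW (↥(maximalRealSubfield L)) L ε) v).comp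
            ((localPiEquiv L (IsCMField.complexConj L) 3 (Matrix.diagonal dV) v).symm.toMonoidHom.comp
              (cmDatumLocalCongr L v T₀ ((hdV0 0).isUnit.map (algebraMap L (UnitaryGroup.LocalRing L v))) h₀).toMonoidHom)))
          (t : ↥(unitaryGroupOfForm (conjLocal L (IsCMField.complexConj L) v) (cmLocalForm L 3 v)))) =
      (lineWeilCM L (Equiv.prodUnique (Fin 1) (Fin 1)) (fun _ : Fin 1 => dV 0) (fun _ => hdV 0) (fun _ => hdV0 0) μ hμ ε v u) ∘ₗ
        (πbar.trans Ψ₁.symm).toLinearMap ∘ₗ (Representation.Coinvariants.mk _) := by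
    refine linearMap_ext_boxSB (v.adicCompletion ↥(maximalRealSubfield L)) (finSumFinEquiv : Fin 1 ⊕ Fin 2 ≃ Fin 3) fun f_l f_p => ?_
    obtain ⟨c, hc'⟩ := hc f_p
    simp only [LinearMap.comp_apply, LinearEquiv.coe_coe, LinearEquiv.trans_apply]
    rw [omega_ch_torus_boxSB L dV hdV hdV0 ε v μ hμ T₀ h₀ hinl u t ht f_l f_p, hπ, hπ, LinearMap.comp_apply, LinearMap.comp_apply,
      LinearEquiv.coe_coe, hc', hc', map_smul, map_smul, map_smul, LinearEquiv.symm_apply_apply, LinearEquiv.symm_apply_apply]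
  have hf := LinearMap.congr_fun hAB f
  simp only [LinearMap.comp_apply, LinearEquiv.coe_toLinearMap] at hf
  exact hf

end Head

end Summit.HodgeConjecture.HodgeConjecture.Cruxes.H413.F0P2oLineJacquetAtBlockFrame

end
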